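import Summits.NavierStokesRegularity.NavierStokesRegularity.Theorems.HodographBetchovSlowClassProductionSingularGerm

/-!
# `SlowClassProduction` (stmt-NavierStokesRegularity-15831) — germ budgets from per-slice bounds with an `L¹`-in-time rate

Route `HodographBetchov`, crux 2, line `near_field`.  The singular-germ residue of the crux
(`slowClassProduction_of_singularGermBudget`) asks for a space-time absolute production budget of the
slow class inside a parabolic germ `{T − ρ ≤ s} × B(x₀, ρ)` of a singular point.  Blow-up heuristics
are per TIME SLICE: "the slow production rate at time `s` is `≲ l^β (T − s)^{(β−3)/2}`" (the
Łojasiewicz census of the crux idea `type-one-stagnation-census`, `β ≥ 2` under Type I).  This file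
provides the transfer (Tonelli):

* `germBudget_of_sliceBound` — for a classical solution on `[0,T)`, if on the time slices
  `s ∈ [T − ρ, T)` the production is absolutely integrable on the slow part of the ball
  `{‖u(s,·)‖ ≤ l} ∩ B(x₀, ρ)` with `∫ |P(s,·)| ≤ g(s)` and `g ∈ L¹(T − ρ, T)`, then the germ region
  carries `∫ |P| ≤ ‖g‖_{L¹}` uniformly in `t < T` (product measure, indicator bookkeeping,
  `lintegral_prod_le`);
* `slowClassProduction_of_singularSliceBound` — the crux from per-slice bounds with an integrable
  rate at the singular, slow-accumulating points of maximal solutions.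
-/

noncomputable section

-- the summit and its single problem share the name `NavierStokesRegularity` (D-0017 nested layout)
set_option linter.dupNamespace false

namespace Summit.NavierStokesRegularity.NavierStokesRegularity.Theorems.SlowClassProduction.NearField

open Set MeasureTheory Function Metric Filter Topology Literature.Analysis.FluidPDE
open scoped ENNReal NNReal ContDiff RealInnerProductSpace

/-- **Germ budget from slice bounds with an integrable rate.**  For a classical solution `(u,p)` of
unforced Navier–Stokes on `ℝ³ × [0,T)`, a level `l`, a centre `x₀`, a germ size `ρ > 0` and a rate
`g ∈ L¹(T − ρ, T)`: if for every `s ∈ [T − ρ, T)` the production `P(s,·) = ⟪ω, ∇u ω⟫(s,·)` is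
integrable on `{x : ‖u(s,x)‖ ≤ l, dist x x₀ < ρ}` with `∫ |P(s,·)| ≤ g(s)`, then for all `t < T` the
production is integrable on the slow class inside the germ region `{T − ρ ≤ s} × B(x₀, ρ)` up to
time `t`, with `∫ |P| ≤ ∫_{(T−ρ,T)} ‖g‖`.  Proof: the germ piece is measurable and lies in the open
slab where `P` is continuous; its indicator integrates, slice by slice, to at most
`1_{[T−ρ,T)}(s) · ofReal (g s)` (`lintegral_prod_le`, the slice integrability turning `∫⁻` into
`ofReal ∫`), whence the `L¹` bound. [folklore] -/
theorem germBudget_of_sliceBound {ν T : ℝ}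
    {u : ℝ → EuclideanSpace ℝ (Fin 3) → EuclideanSpace ℝ (Fin 3)}
    {p : ℝ → EuclideanSpace ℝ (Fin 3) → ℝ}
    (hcl : Literature.Analysis.FluidPDE.IsClassicalNSSolutionOn (Set.Ico 0 T) ν 0 u p) {l : ℝ}
    {x₀ : EuclideanSpace ℝ (Fin 3)} {ρ : ℝ} {g : ℝ → ℝ}
    (hg : MeasureTheory.IntegrableOn g (Set.Ioo (T - ρ) T))
    (hslice : ∀ s ∈ Set.Ico (T - ρ) T,
      MeasureTheory.IntegrableOn
        (fun x : EuclideanSpace ℝ (Fin 3) =>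
          inner ℝ (Literature.Analysis.FluidPDE.curl (u s) x)
            (fderiv ℝ (u s) x (Literature.Analysis.FluidPDE.curl (u s) x)))
        {x : EuclideanSpace ℝ (Fin 3) | ‖u s x‖ ≤ l ∧ dist x x₀ < ρ} ∧
      ∫ x in {x : EuclideanSpace ℝ (Fin 3) | ‖u s x‖ ≤ l ∧ dist x x₀ < ρ},
        |inner ℝ (Literature.Analysis.FluidPDE.curl (u s) x)
          (fderiv ℝ (u s) x (Literature.Analysis.FluidPDE.curl (u s) x))| ≤ g s) :
    ∃ C : ℝ, ∀ t ∈ Set.Ico 0 T,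
      MeasureTheory.IntegrableOn
        (fun z : ℝ × EuclideanSpace ℝ (Fin 3) =>
          inner ℝ (Literature.Analysis.FluidPDE.curl (u z.1) z.2)
            (fderiv ℝ (u z.1) z.2 (Literature.Analysis.FluidPDE.curl (u z.1) z.2)))
        ({z : ℝ × EuclideanSpace ℝ (Fin 3) | z.1 ∈ Set.Ioo 0 t ∧ ‖u z.1 z.2‖ ≤ l} ∩
          {z : ℝ × EuclideanSpace ℝ (Fin 3) | T - ρ ≤ z.1 ∧ dist z.2 x₀ < ρ}) ∧
      ∫ z in ({z : ℝ × EuclideanSpace ℝ (Fin 3) | z.1 ∈ Set.Ioo 0 t ∧ ‖u z.1 z.2‖ ≤ l} ∩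
          {z : ℝ × EuclideanSpace ℝ (Fin 3) | T - ρ ≤ z.1 ∧ dist z.2 x₀ < ρ}),
        |inner ℝ (Literature.Analysis.FluidPDE.curl (u z.1) z.2)
          (fderiv ℝ (u z.1) z.2 (Literature.Analysis.FluidPDE.curl (u z.1) z.2))| ≤ C := by
  -- notation
  set P : ℝ × EuclideanSpace ℝ (Fin 3) → ℝ := fun z =>
    inner ℝ (Literature.Analysis.FluidPDE.curl (u z.1) z.2)
      (fderiv ℝ (u z.1) z.2 (Literature.Analysis.FluidPDE.curl (u z.1) z.2)) with hP_def
  set B : ℝ → Set (EuclideanSpace ℝ (Fin 3)) := fun s =>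
    {x : EuclideanSpace ℝ (Fin 3) | ‖u s x‖ ≤ l ∧ dist x x₀ < ρ} with hB_def
  -- continuity of the production on the open slab
  have hclo : IsClassicalNSSolutionOn (Ioo 0 T) ν 0 u p :=
    hcl.mono Ioo_subset_Ico_self isOpen_Ioo.uniqueDiffOn
  have hDcont : ContinuousOn (fun z : ℝ × EuclideanSpace ℝ (Fin 3) => fderiv ℝ (u z.1) z.2)
      (Ioo 0 T ×ˢ univ) :=
    continuousOn_fderiv_slice_of_contDiffOn (hclo.smooth_velocity.of_le (by norm_cast))
      isOpen_Ioo.uniqueDiffOn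
  have hωcont : ContinuousOn (fun z : ℝ × EuclideanSpace ℝ (Fin 3) => curl (u z.1) z.2)
      (Ioo 0 T ×ˢ univ) :=
    curlCLM.continuous.comp_continuousOn hDcont
  have hPcont : ContinuousOn P (Ioo 0 T ×ˢ univ) := hωcont.inner (hDcont.clm_apply hωcont)
  have hU : ContinuousOn (uncurry u) (Set.Ico 0 T ×ˢ (Set.univ : Set (EuclideanSpace ℝ (Fin 3)))) :=
    hcl.smooth_velocity.continuousOn
  -- the `L¹` norm of the rate
  have hfin : ∫⁻ s in Ioo (T - ρ) T, ‖g s‖ₑ < ⊤ := hg.2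
  refine ⟨(∫⁻ s in Ioo (T - ρ) T, ‖g s‖ₑ).toReal, fun t ht => ?_⟩
  set A : Set (ℝ × EuclideanSpace ℝ (Fin 3)) :=
    {z : ℝ × EuclideanSpace ℝ (Fin 3) | z.1 ∈ Set.Ioo 0 t ∧ ‖u z.1 z.2‖ ≤ l} ∩
      {z : ℝ × EuclideanSpace ℝ (Fin 3) | T - ρ ≤ z.1 ∧ dist z.2 x₀ < ρ} with hA_def
  change IntegrableOn P A ∧ ∫ z in A, |P z| ≤ _
  have hA : MeasurableSet A := (measurableSet_slowClass ht.2.le hU).inter (measurableSet_germ T ρ x₀)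
  have hAsub : A ⊆ Ioo (0 : ℝ) T ×ˢ (univ : Set (EuclideanSpace ℝ (Fin 3))) := fun z hz =>
    mk_mem_prod ⟨hz.1.1.1, hz.1.1.2.trans ht.2⟩ (mem_univ _)
  have hmeasP : AEStronglyMeasurable P (volume.restrict A) :=
    (hPcont.mono hAsub).aestronglyMeasurable hA
  -- slice by slice, the indicator of the germ piece integrates to at most the rate
  have hpt : ∀ s : ℝ, ∫⁻ x, A.indicator (fun z => ‖P z‖ₑ) (s, x) ≤
      (Ico (T - ρ) T).indicator (fun s => ENNReal.ofReal (g s)) s := by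
    intro s
    by_cases hs : s ∈ Set.Ioo 0 t ∧ T - ρ ≤ s
    · have hsI : s ∈ Ico (T - ρ) T := ⟨hs.2, hs.1.2.trans ht.2⟩
      rw [indicator_of_mem hsI]
      have heq : ∀ x, A.indicator (fun z => ‖P z‖ₑ) (s, x) =
          (B s).indicator (fun x => ‖P (s, x)‖ₑ) x := by
        intro x
        by_cases hx : ‖u s x‖ ≤ l ∧ dist x x₀ < ρ
        · have hxB : x ∈ B s := hx
          have hzA : ((s, x) : ℝ × EuclideanSpace ℝ (Fin 3)) ∈ A := ⟨⟨hs.1, hx.1⟩, hs.2, hx.2⟩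
          rw [indicator_of_mem hzA, indicator_of_mem hxB]
        · have hxB : x ∉ B s := hx
          have hzA : ((s, x) : ℝ × EuclideanSpace ℝ (Fin 3)) ∉ A := fun h => hx ⟨h.1.2, h.2.2⟩
          rw [indicator_of_notMem hzA, indicator_of_notMem hxB]
      obtain ⟨hint, hle⟩ := hslice s hsI
      calc ∫⁻ x, A.indicator (fun z => ‖P z‖ₑ) (s, x)
          = ∫⁻ x, (B s).indicator (fun x => ‖P (s, x)‖ₑ) x := lintegral_congr heq
        _ ≤ ∫⁻ x in B s, ‖P (s, x)‖ₑ := lintegral_indicator_le _ _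
        _ = ENNReal.ofReal (∫ x in B s, ‖P (s, x)‖) :=
            (ofReal_integral_norm_eq_lintegral_enorm hint).symm
        _ ≤ ENNReal.ofReal (g s) := by
            refine ENNReal.ofReal_le_ofReal ?_
            simpa only [Real.norm_eq_abs] using hle
    · have heq : ∀ x, A.indicator (fun z => ‖P z‖ₑ) (s, x) = 0 := fun x =>
        indicator_of_notMem (fun h => hs ⟨h.1.1, h.2.1⟩) _
      rw [lintegral_congr heq, lintegral_zero]
      exact zero_le
  -- Tonelli
  have hkey : ∫⁻ z in A, ‖P z‖ₑ ≤ ∫⁻ s in Ioo (T - ρ) T, ‖g s‖ₑ := by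
    rw [← lintegral_indicator hA, Measure.volume_eq_prod ℝ (EuclideanSpace ℝ (Fin 3))]
    calc ∫⁻ z, A.indicator (fun z => ‖P z‖ₑ) z ∂((volume : Measure ℝ).prod volume)
        ≤ ∫⁻ s, ∫⁻ x, A.indicator (fun z => ‖P z‖ₑ) (s, x) := lintegral_prod_le _
      _ ≤ ∫⁻ s, (Ico (T - ρ) T).indicator (fun s => ENNReal.ofReal (g s)) s := lintegral_mono hpt
      _ = ∫⁻ s in Ico (T - ρ) T, ENNReal.ofReal (g s) := lintegral_indicator measurableSet_Ico _
      _ = ∫⁻ s in Ioo (T - ρ) T, ENNReal.ofReal (g s) := by rw [restrict_Ioo_eq_restrict_Ico]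
      _ ≤ ∫⁻ s in Ioo (T - ρ) T, ‖g s‖ₑ := by
          refine lintegral_mono fun s => ?_
          rw [Real.enorm_eq_ofReal_abs]
          exact ENNReal.ofReal_le_ofReal (le_abs_self _)
  have hPA : IntegrableOn P A := ⟨hmeasP, hkey.trans_lt hfin⟩
  refine ⟨hPA, ?_⟩
  calc ∫ z in A, |P z| = ∫ z in A, ‖P z‖ := by simp only [Real.norm_eq_abs]
    _ = (∫⁻ z in A, ‖P z‖ₑ).toReal := integral_norm_eq_lintegral_enorm hmeasP
    _ ≤ (∫⁻ s in Ioo (T - ρ) T, ‖g s‖ₑ).toReal := ENNReal.toReal_mono hfin.ne hkey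

/-- **The crux from per-slice bounds with an integrable rate at singular points.**  If for every
`ν, T > 0`, every maximal smooth solution `(u,p)` with lifespan `T` that is Leray–Hopf from its
rapidly decaying datum, every level `l > 0` and every point `x₀` that is singular at time `T` and
`l`-slow-accumulating, there are a germ size `ρ > 0` and a rate `g ∈ L¹(T − ρ, T)` bounding, for
every slice `s ∈ [T − ρ, T)`, the absolute production of the slow part `{‖u(s,·)‖ ≤ l}` of the ball
`B(x₀, ρ)` (with integrability), then `SlowClassProduction` holds (`germBudget_of_sliceBound` +
`slowClassProduction_of_singularGermBudget`).  Under a Type-I / self-similar census the rate is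
`g(s) = C l^β (T − s)^{(β−3)/2}` with `β ≥ 2`, integrable. [folklore] -/
theorem slowClassProduction_of_singularSliceBound :
    (∀ (ν T : ℝ), 0 < ν → 0 < T →
      ∀ (u : ℝ → EuclideanSpace ℝ (Fin 3) → EuclideanSpace ℝ (Fin 3))
        (p : ℝ → EuclideanSpace ℝ (Fin 3) → ℝ),
        Literature.Analysis.FluidPDE.IsMaximalSmoothSolution ν 0 u p T →
        Literature.Analysis.FluidPDE.IsLerayHopfOn T ν 0 (u 0) u →
        Literature.Analysis.FluidPDE.HasRapidSpatialDecay (u 0) →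
        ∀ l : ℝ, 0 < l → ∀ x₀ : EuclideanSpace ℝ (Fin 3),
          (∀ r : ℝ, 0 < r → r ^ 2 < T →
            eLpNorm (Function.uncurry u) ⊤ (MeasureTheory.volume.restrict
              (Literature.Analysis.FluidPDE.parabolicCylinder r ((T : ℝ), x₀))) = ⊤) →
          (∀ ρ : ℝ, 0 < ρ → ∃ t ∈ Set.Ico 0 T,
            ({z : ℝ × EuclideanSpace ℝ (Fin 3) | z.1 ∈ Set.Ioo 0 t ∧ ‖u z.1 z.2‖ ≤ l} ∩
              {z : ℝ × EuclideanSpace ℝ (Fin 3) | T - ρ ≤ z.1 ∧ dist z.2 x₀ < ρ}).Nonempty) →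
          ∃ ρ : ℝ, 0 < ρ ∧ ∃ g : ℝ → ℝ, MeasureTheory.IntegrableOn g (Set.Ioo (T - ρ) T) ∧
            ∀ s ∈ Set.Ico (T - ρ) T,
              MeasureTheory.IntegrableOn
                (fun x : EuclideanSpace ℝ (Fin 3) =>
                  inner ℝ (Literature.Analysis.FluidPDE.curl (u s) x)
                    (fderiv ℝ (u s) x (Literature.Analysis.FluidPDE.curl (u s) x)))
                {x : EuclideanSpace ℝ (Fin 3) | ‖u s x‖ ≤ l ∧ dist x x₀ < ρ} ∧
              ∫ x in {x : EuclideanSpace ℝ (Fin 3) | ‖u s x‖ ≤ l ∧ dist x x₀ < ρ},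
                |inner ℝ (Literature.Analysis.FluidPDE.curl (u s) x)
                  (fderiv ℝ (u s) x (Literature.Analysis.FluidPDE.curl (u s) x))| ≤ g s) →
    Summit.NavierStokesRegularity.NavierStokesRegularity.Theses.HodographBetchov.SlowClassProduction := by
  intro hS
  refine slowClassProduction_of_singularGermBudget ?_
  intro ν T hν hT u p hmax hLH hdec l hl x₀ hsing hacc
  obtain ⟨ρ, hρ, g, hg, hslice⟩ := hS ν T hν hT u p hmax hLH hdec l hl x₀ hsing hacc
  exact ⟨ρ, hρ, germBudget_of_sliceBound hmax.1 hg hslice⟩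

end Summit.NavierStokesRegularity.NavierStokesRegularity.Theorems.SlowClassProduction.NearField

end
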